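import Mathlib
import HarnessLib
import Summits.HubbardSuperconductivity.HubbardSuperconductivity.Theses.WeakCouplingBCS
import Summits.HubbardSuperconductivity.HubbardSuperconductivity.Theorems.WeakCouplingBCSH1TwoPointLimitKLScaleDTypedCrux
import Summits.HubbardSuperconductivity.HubbardSuperconductivity.Theorems.WeakCouplingBCSH1TwoPointLimitKLScaleDFillingsB
import Summits.HubbardSuperconductivity.HubbardSuperconductivity.Theorems.WeakCouplingBCSH1TwoPointLimitKLOnsetBridge

/-!
# Route `WeakCouplingBCS` (ladder H3) — the door from WINDOWED normal-phase control: the H3 consumers of rung R2d need the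
# theorem half only on the certificate window `δ ∈ [0.10, 0.20]`; the ONSET leaf `H1TwoPointLimitKLOnsetD` is a drop-in replacement

Cell `gate-hubbard-kl`, seat `hubbard-kl-h1-p1` gen 2 (row «R2dH1 leaf → WeakCouplingBCS/H3 consumers»; LADDER-Hubbard §0 (D),
caveat (ii): the onset leaf R2dH1′ is «sharper in scale, narrower in window» than the leaf of record R2dH1; WORDING OF RECORD (ii)).
Support file for crux 4 `WcbcsBcsConstruction` (stmt-HubbardSuperconductivity-2010).  Companion of
`…Theorems.WeakCouplingBCSH1TwoPointLimitKLScaleDDoor` (gen 0: {leaf BY NAME on `δ ∈ [0.10, 0.35]`, cert, relativised (M_loc), crux 2}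
⇒ summit, through the level window `[-21/50, -7/20]` and the filling `13/20 ≤ n(-21/50)`), of `…TypedCrux`, and of seat h1-p2's
`…Theorems.WeakCouplingBCSH1TwoPointLimitKLOnsetBridge` (`control_certWindow_of_onset`: the onset leaf implies the leaf's body on
`[0.10, 0.20]`, modulo the records).

THE POINT.  Every H3 consumer of gen 0 used the theorem half through ONE shape only: normal-phase control (thermal two-point limits
for all `0 < U ≤ U₀`, `0 < β ≤ e^{c/U²}`) on a level window of chemical potentials inside the certificate's `μ`-window.  This file
derives that shape from control on the CERTIFICATE WINDOW `δ ∈ [0.10, 0.20]` ALONE — the hypothesis `hctl` below is, verbatim, the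
common conclusion of `R2dH1.control_certWindow` (from the leaf) and of `R2dH1.control_certWindow_of_onset` (from the onset leaf) —
so that the whole door runs on the window of record:

§1 `control_at_mu_of_controlCertWindow` / `control_on_muWindow_of_controlCertWindow` / `control_on_levelWindow_of_controlCertWindow`
   — the `δ → μ` transport for windowed control: control at every `μ ∈ [-4, 4]` with free filling `4/5 ≤ n(μ) ≤ 9/10`
   (`δ := 1 - n(μ) ∈ [0.10, 0.20]`, `μ(δ) = μ`), hence on the level window `[-2/5, -7/20]` by the certified fillings
   `klwM_filling_ge : 4/5 ≤ n(-2/5)` (companion `…FillingsB`, this seat) and `klwU_filling_le : n(-7/20) ≤ 9/10` (gen 0).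
§2 `shiftedWindowFloor_of_controlCertWindow_of_klMechanismRel` and the four conclusions — {windowed control `hctl`, the three window
   enclosure records (cert form (A); `B1g` leads by `γU²` on `[-2/5, -7/20] ⊂ [-0.42749, -0.1775]`), the RELATIVISED research stub `hBr`
   «(M_loc | normal-phase control)» VERBATIM as in gen 0's door} ⇒ an order floor `e^{-C/U²} ≤ dWaveOrderParameter U μ` on the shifted
   windows `[-2/5 + U/2, -7/20]`; hence (+ crux 2 `WcbcsSsbToTorusLRO` BY NAME) `HubbardSuperconductivity`
   (`hubbardSuperconductivity_of_controlCertWindow_of_klMechanismRel_of_ssbToTorusLRO`), the thin crux, the rate-keeping crux, and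
   (+ (D_loc) VERBATIM) the TYPED crux `WcbcsBcsConstruction` (`n(-2/5) ≥ 4/5 > 1/2` feeds the generic EOS composition of `…TypedCrux`).
§3 COROLLARIES from the ONSET leaf BY NAME: `hubbardSuperconductivity_of_onsetLeaf_of_klMechanismRel_of_ssbToTorusLRO`,
   `thinCrux_of_onsetLeaf_of_klMechanismRel`, `rateKeepingCrux_of_onsetLeaf_of_klMechanismRel`,
   `wcbcsBcsConstruction_of_onsetLeaf_of_klMechanismRel_of_noDensityJump` — on H3, R2dH1′ (stmt-19165) replaces R2dH1 (stmt-19419) in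
   every door of record, with the same bridge hypothesis and the same open content ((M_loc)-relativised + crux 2 [+ (D_loc)]).
   (From the leaf itself the four conclusions are gen 0's theorems; routing the leaf through `R2dH1.control_certWindow` and §2 gives
   them again, which shows the door consumes the theorem half on `[0.10, 0.20]` only — no separate statement is recorded for that.)

Sorry-free, standard axioms, no definition; `hBr` / (D_loc) are byte-identical to gen 0's door / the registered stub of stmt-2010.
HONEST READING unchanged (door §3, audit `…KLBridgeAudit` §4): the antecedent of `hBr` is the existence SHADOW of stage 1; the door
fixes the logical shape and the names, not the analysis.  Sources: T. Koma, H. Tasaki, J. Stat. Phys. 76 (1994) 745, §1;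
S. Raghu, S. A. Kivelson, D. J. Scalapino, Phys. Rev. B 81 (2010) 224505, §II (4), §III Fig. 2; G. Benfatto, A. Giuliani,
V. Mastropietro, Ann. Henri Poincaré 7 (2006) 809, Thm 1.1.
-/

noncomputable section

-- the tree's namespace `Summit.<Summit>.<Problem>.Theorems` repeats the summit name by design (D-0017)
set_option linter.dupNamespace false

namespace Summit.HubbardSuperconductivity.HubbardSuperconductivity.Theorems.R2dH1

open Filter Set
open Literature.MathematicalPhysics.QuantumLattice Literature.Probability.LatticeModels
open Summit.HubbardSuperconductivity.HubbardSuperconductivity.Theses.WeakCouplingBCS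
  (H1TwoPointLimitKLScaleD H1TwoPointLimitKLOnsetD WcbcsSsbToTorusLRO WcbcsBcsConstruction)
open scoped Topology

/-! ### §1 The `δ → μ` transport for control on the certificate window -/

/-- **Windowed control at a given chemical potential.** If the thermal two-point functions at `μ(δ)` converge for every
`δ ∈ [0.10, 0.20]` (all `0 < U ≤ U₀`, `0 < β ≤ e^{c/U²}`), then they converge AT every `μ ∈ [-4, 4]` whose free filling satisfies
`4/5 ≤ n(μ) ≤ 9/10`: `δ := 1 - n(μ) ∈ [0.10, 0.20]` and `μ(δ) = μ` (`chemicalPotentialOfDensity_eq_of_filling_eq`), same constants.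
[cite: RaghuKivelsonScalapino2010, §II (4)] -/
theorem control_at_mu_of_controlCertWindow
    (hctl : ∃ U₀ c : ℝ, 0 < U₀ ∧ 0 < c ∧ ∀ δ ∈ Set.Icc (0.10 : ℝ) 0.20, ∀ U β : ℝ, 0 < U → U ≤ U₀ → 0 < β →
      β ≤ Real.exp (c / U ^ 2) → ∀ (x y : Site 2) (σ σ' : Fin 2), ∃ S : ℂ,
        Tendsto (fun L : ℕ => hubbardThermalTwoPoint β U
          (chemicalPotentialOfDensity (squareDispersion 1 0) (1 - δ)) L x y σ σ') atTop (𝓝 S)) :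
    ∃ U₀ c : ℝ, 0 < U₀ ∧ 0 < c ∧ ∀ μ ∈ Set.Icc (-4 : ℝ) 4,
      (4 : ℝ) / 5 ≤ KohnLuttinger.filling (squareDispersion 1 0) μ →
      KohnLuttinger.filling (squareDispersion 1 0) μ ≤ 9 / 10 →
      ∀ U β : ℝ, 0 < U → U ≤ U₀ → 0 < β → β ≤ Real.exp (c / U ^ 2) →
        ∀ (x y : Site 2) (σ σ' : Fin 2), ∃ S : ℂ,
          Tendsto (fun L : ℕ => hubbardThermalTwoPoint β U μ L x y σ σ') atTop (𝓝 S) := by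
  obtain ⟨U₀, c, hU₀, hc, H⟩ := hctl
  refine ⟨U₀, c, hU₀, hc, fun μ hμ hn₁ hn₂ => ?_⟩
  set n := KohnLuttinger.filling (squareDispersion 1 0) μ with hn
  have hδ : 1 - n ∈ Set.Icc (0.10 : ℝ) 0.20 := by
    constructor <;> norm_num <;> linarith
  have hμn : chemicalPotentialOfDensity (squareDispersion 1 0) (1 - (1 - n)) = μ := by
    rw [sub_sub_cancel]
    exact chemicalPotentialOfDensity_eq_of_filling_eq (by linarith) hμ rfl
  have key := H (1 - n) hδ
  rw [hμn] at key
  exact key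

/-- **Windowed control on a `μ`-window with certified endpoint fillings** `4/5 ≤ n(μ₁)`, `n(μ₂) ≤ 9/10`, `[μ₁, μ₂] ⊆ [-4, 4]`:
control at every `μ ∈ [μ₁, μ₂]` (monotonicity of the free filling). [folklore] -/
theorem control_on_muWindow_of_controlCertWindow
    (hctl : ∃ U₀ c : ℝ, 0 < U₀ ∧ 0 < c ∧ ∀ δ ∈ Set.Icc (0.10 : ℝ) 0.20, ∀ U β : ℝ, 0 < U → U ≤ U₀ → 0 < β →
      β ≤ Real.exp (c / U ^ 2) → ∀ (x y : Site 2) (σ σ' : Fin 2), ∃ S : ℂ,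
        Tendsto (fun L : ℕ => hubbardThermalTwoPoint β U
          (chemicalPotentialOfDensity (squareDispersion 1 0) (1 - δ)) L x y σ σ') atTop (𝓝 S))
    {μ₁ μ₂ : ℝ} (h4 : -4 ≤ μ₁) (h4' : μ₂ ≤ 4)
    (hn₁ : (4 : ℝ) / 5 ≤ KohnLuttinger.filling (squareDispersion 1 0) μ₁)
    (hn₂ : KohnLuttinger.filling (squareDispersion 1 0) μ₂ ≤ 9 / 10) :
    ∃ U₀ c : ℝ, 0 < U₀ ∧ 0 < c ∧ ∀ μ ∈ Set.Icc μ₁ μ₂,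
      ∀ U β : ℝ, 0 < U → U ≤ U₀ → 0 < β → β ≤ Real.exp (c / U ^ 2) →
        ∀ (x y : Site 2) (σ σ' : Fin 2), ∃ S : ℂ,
          Tendsto (fun L : ℕ => hubbardThermalTwoPoint β U μ L x y σ σ') atTop (𝓝 S) := by
  obtain ⟨U₀, c, hU₀, hc, H⟩ := control_at_mu_of_controlCertWindow hctl
  refine ⟨U₀, c, hU₀, hc, fun μ hμ => H μ ⟨h4.trans hμ.1, hμ.2.trans h4'⟩ ?_ ?_⟩
  · exact hn₁.trans (monotone_filling hμ.1)
  · exact (monotone_filling hμ.2).trans hn₂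

/-- **Windowed control on the level window `[-2/5, -7/20]`** (certified fillings `klwM_filling_ge : 4/5 ≤ n(-2/5)` and
`klwU_filling_le : n(-7/20) ≤ 9/10`). [folklore] -/
theorem control_on_levelWindow_of_controlCertWindow
    (hctl : ∃ U₀ c : ℝ, 0 < U₀ ∧ 0 < c ∧ ∀ δ ∈ Set.Icc (0.10 : ℝ) 0.20, ∀ U β : ℝ, 0 < U → U ≤ U₀ → 0 < β →
      β ≤ Real.exp (c / U ^ 2) → ∀ (x y : Site 2) (σ σ' : Fin 2), ∃ S : ℂ,
        Tendsto (fun L : ℕ => hubbardThermalTwoPoint β U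
          (chemicalPotentialOfDensity (squareDispersion 1 0) (1 - δ)) L x y σ σ') atTop (𝓝 S)) :
    ∃ U₀ c : ℝ, 0 < U₀ ∧ 0 < c ∧ ∀ μ ∈ Set.Icc (-(2:ℝ) / 5) (-(7:ℝ) / 20),
      ∀ U β : ℝ, 0 < U → U ≤ U₀ → 0 < β → β ≤ Real.exp (c / U ^ 2) →
        ∀ (x y : Site 2) (σ σ' : Fin 2), ∃ S : ℂ,
          Tendsto (fun L : ℕ => hubbardThermalTwoPoint β U μ L x y σ σ') atTop (𝓝 S) :=
  control_on_muWindow_of_controlCertWindow hctl (by norm_num) (by norm_num) klwM_filling_ge klwU_filling_le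

/-! ### §2 The door from windowed control -/

/-- **`B1g` leading on the level window `[-2/5, -7/20]`** from the three window records of R2d's certificate half
(`r2dCert_leading_levelWindow` restricted; `[-2/5, -7/20] ⊂ [-0.42749, -7/20]`). [cite: RaghuKivelsonScalapino2010, §III Fig. 2] -/
theorem r2dCert_leading_levelWindow' (hA : klCertB1gWinA.EnclosuresB1g) (hB : klCertB1gWinB.EnclosuresB1g)
    (hC : klCertB1gWinC.EnclosuresB1g) :
    ∃ γ : ℝ, 0 < γ ∧ ∀ U ∈ Set.Ioo (0:ℝ) 1, ∀ μ ∈ Set.Icc (-(2:ℝ) / 5) (-(7:ℝ) / 20), ∀ χ : D4Irrep, χ ≠ D4Irrep.B1g →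
      channelInf (squareDispersion 1 0) μ U D4Irrep.B1g + γ * U ^ 2 ≤ channelInf (squareDispersion 1 0) μ U χ := by
  obtain ⟨γ, hγ, hlead⟩ := r2dCert_leading_levelWindow hA hB hC
  exact ⟨γ, hγ, fun U hU μ hμ χ hχ => hlead U hU μ ⟨le_trans (by norm_num) hμ.1, hμ.2⟩ χ hχ⟩

/-- **Windowed control + certificate + «(M_loc | normal-phase control)» ⇒ the order floor on the shifted windows
`[-2/5 + U/2, -7/20]`.**  `hctl` = control on `δ ∈ [0.10, 0.20]` (conclusion shape of `control_certWindow` /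
`control_certWindow_of_onset`); `hBr` = gen 0's relativised research stub VERBATIM. [cite: KomaTasaki1994, §1] -/
theorem shiftedWindowFloor_of_controlCertWindow_of_klMechanismRel
    (hctl : ∃ U₀ c : ℝ, 0 < U₀ ∧ 0 < c ∧ ∀ δ ∈ Set.Icc (0.10 : ℝ) 0.20, ∀ U β : ℝ, 0 < U → U ≤ U₀ → 0 < β →
      β ≤ Real.exp (c / U ^ 2) → ∀ (x y : Site 2) (σ σ' : Fin 2), ∃ S : ℂ,
        Tendsto (fun L : ℕ => hubbardThermalTwoPoint β U
          (chemicalPotentialOfDensity (squareDispersion 1 0) (1 - δ)) L x y σ σ') atTop (𝓝 S))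
    (hA : klCertB1gWinA.EnclosuresB1g) (hB : klCertB1gWinB.EnclosuresB1g) (hC : klCertB1gWinC.EnclosuresB1g)
    (hBr : ∀ μ₁ μ₂ γ U₁ U₀ c : ℝ, -2 ≤ μ₁ → μ₁ < μ₂ → μ₂ ≤ -(3:ℝ) / 10 → 0 < γ → 0 < U₁ → 0 < U₀ → 0 < c →
      (∀ μ ∈ Set.Icc μ₁ μ₂, ∀ U β : ℝ, 0 < U → U ≤ U₀ → 0 < β → β ≤ Real.exp (c / U ^ 2) →
        ∀ (x y : Site 2) (σ σ' : Fin 2), ∃ S : ℂ,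
          Tendsto (fun L : ℕ => hubbardThermalTwoPoint β U μ L x y σ σ') atTop (𝓝 S)) →
      (∀ U ∈ Set.Ioo (0:ℝ) U₁, ∀ μ ∈ Set.Icc μ₁ μ₂, ∀ χ : D4Irrep, χ ≠ D4Irrep.B1g →
        channelInf (squareDispersion 1 0) μ U D4Irrep.B1g + γ * U ^ 2 ≤ channelInf (squareDispersion 1 0) μ U χ) →
      ∃ U₀' C : ℝ, 0 < U₀' ∧ 0 < C ∧ ∀ U ∈ Set.Ioo (0:ℝ) U₀', ∀ μ ∈ Set.Icc (μ₁ + U / 2) μ₂,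
        Real.exp (-C / U ^ 2) ≤ dWaveOrderParameter U μ) :
    ∃ U₀ C : ℝ, 0 < U₀ ∧ 0 < C ∧ ∀ U ∈ Set.Ioo (0:ℝ) U₀, ∀ μ ∈ Set.Icc (-(2:ℝ) / 5 + U / 2) (-(7:ℝ) / 20),
      Real.exp (-C / U ^ 2) ≤ dWaveOrderParameter U μ := by
  obtain ⟨U₀, c, hU₀, hc, hlev⟩ := control_on_levelWindow_of_controlCertWindow hctl
  obtain ⟨γ, hγ, hlead⟩ := r2dCert_leading_levelWindow' hA hB hC
  exact hBr (-(2:ℝ) / 5) (-(7:ℝ) / 20) γ 1 U₀ c (by norm_num) (by norm_num) (by norm_num) hγ one_pos hU₀ hc hlev hlead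

/-- **THE WINDOWED DOOR: control on the certificate window + certificate + «(M_loc | normal-phase control)» + crux 2 ⇒ the
summit.**  Hypotheses: `hctl` (thermal two-point limits at `μ(δ)` for every `δ ∈ [0.10, 0.20]`, all `0 < U ≤ U₀`, `0 < β ≤ e^{c/U²}`
— the theorem half of rung R2d ON THE WINDOW OF RECORD ONLY), the three window enclosure records (certificate half, form (A)), gen 0's
relativised research stub `hBr` VERBATIM, and crux 2 `WcbcsSsbToTorusLRO` BY NAME.  Proof: §1 transport to `[-2/5, -7/20]`, the floor
on `[-2/5 + U/2, -7/20]`, thin order (`thinOrder_of_shiftedWindowFloor`), thin sufficiency.  Every binder is load-bearing.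
[cite: KomaTasaki1994, §1] -/
theorem hubbardSuperconductivity_of_controlCertWindow_of_klMechanismRel_of_ssbToTorusLRO
    (hctl : ∃ U₀ c : ℝ, 0 < U₀ ∧ 0 < c ∧ ∀ δ ∈ Set.Icc (0.10 : ℝ) 0.20, ∀ U β : ℝ, 0 < U → U ≤ U₀ → 0 < β →
      β ≤ Real.exp (c / U ^ 2) → ∀ (x y : Site 2) (σ σ' : Fin 2), ∃ S : ℂ,
        Tendsto (fun L : ℕ => hubbardThermalTwoPoint β U
          (chemicalPotentialOfDensity (squareDispersion 1 0) (1 - δ)) L x y σ σ') atTop (𝓝 S))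
    (hA : klCertB1gWinA.EnclosuresB1g) (hB : klCertB1gWinB.EnclosuresB1g) (hC : klCertB1gWinC.EnclosuresB1g)
    (hBr : ∀ μ₁ μ₂ γ U₁ U₀ c : ℝ, -2 ≤ μ₁ → μ₁ < μ₂ → μ₂ ≤ -(3:ℝ) / 10 → 0 < γ → 0 < U₁ → 0 < U₀ → 0 < c →
      (∀ μ ∈ Set.Icc μ₁ μ₂, ∀ U β : ℝ, 0 < U → U ≤ U₀ → 0 < β → β ≤ Real.exp (c / U ^ 2) →
        ∀ (x y : Site 2) (σ σ' : Fin 2), ∃ S : ℂ,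
          Tendsto (fun L : ℕ => hubbardThermalTwoPoint β U μ L x y σ σ') atTop (𝓝 S)) →
      (∀ U ∈ Set.Ioo (0:ℝ) U₁, ∀ μ ∈ Set.Icc μ₁ μ₂, ∀ χ : D4Irrep, χ ≠ D4Irrep.B1g →
        channelInf (squareDispersion 1 0) μ U D4Irrep.B1g + γ * U ^ 2 ≤ channelInf (squareDispersion 1 0) μ U χ) →
      ∃ U₀' C : ℝ, 0 < U₀' ∧ 0 < C ∧ ∀ U ∈ Set.Ioo (0:ℝ) U₀', ∀ μ ∈ Set.Icc (μ₁ + U / 2) μ₂,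
        Real.exp (-C / U ^ 2) ≤ dWaveOrderParameter U μ)
    (h2 : WcbcsSsbToTorusLRO) : _root_.HubbardSuperconductivity :=
  hubbardSuperconductivity_of_wcbcsSsbToTorusLRO_of_thinOrder h2
    (thinOrder_of_shiftedWindowFloor (μ₁ := -(2:ℝ) / 5) (μ₂ := -(7:ℝ) / 20) (by norm_num) (by norm_num) le_rfl
      (shiftedWindowFloor_of_controlCertWindow_of_klMechanismRel hctl hA hB hC hBr))

/-- **The thin crux from windowed control, the certificate and the relativised stub** (no crux 2: density matching is free,
`wcbcs_thinCrux_of_thinOrder`). [cite: KomaTasaki1994, §1] -/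
theorem thinCrux_of_controlCertWindow_of_klMechanismRel
    (hctl : ∃ U₀ c : ℝ, 0 < U₀ ∧ 0 < c ∧ ∀ δ ∈ Set.Icc (0.10 : ℝ) 0.20, ∀ U β : ℝ, 0 < U → U ≤ U₀ → 0 < β →
      β ≤ Real.exp (c / U ^ 2) → ∀ (x y : Site 2) (σ σ' : Fin 2), ∃ S : ℂ,
        Tendsto (fun L : ℕ => hubbardThermalTwoPoint β U
          (chemicalPotentialOfDensity (squareDispersion 1 0) (1 - δ)) L x y σ σ') atTop (𝓝 S))
    (hA : klCertB1gWinA.EnclosuresB1g) (hB : klCertB1gWinB.EnclosuresB1g) (hC : klCertB1gWinC.EnclosuresB1g)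
    (hBr : ∀ μ₁ μ₂ γ U₁ U₀ c : ℝ, -2 ≤ μ₁ → μ₁ < μ₂ → μ₂ ≤ -(3:ℝ) / 10 → 0 < γ → 0 < U₁ → 0 < U₀ → 0 < c →
      (∀ μ ∈ Set.Icc μ₁ μ₂, ∀ U β : ℝ, 0 < U → U ≤ U₀ → 0 < β → β ≤ Real.exp (c / U ^ 2) →
        ∀ (x y : Site 2) (σ σ' : Fin 2), ∃ S : ℂ,
          Tendsto (fun L : ℕ => hubbardThermalTwoPoint β U μ L x y σ σ') atTop (𝓝 S)) →
      (∀ U ∈ Set.Ioo (0:ℝ) U₁, ∀ μ ∈ Set.Icc μ₁ μ₂, ∀ χ : D4Irrep, χ ≠ D4Irrep.B1g →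
        channelInf (squareDispersion 1 0) μ U D4Irrep.B1g + γ * U ^ 2 ≤ channelInf (squareDispersion 1 0) μ U χ) →
      ∃ U₀' C : ℝ, 0 < U₀' ∧ 0 < C ∧ ∀ U ∈ Set.Ioo (0:ℝ) U₀', ∀ μ ∈ Set.Icc (μ₁ + U / 2) μ₂,
        Real.exp (-C / U ^ 2) ≤ dWaveOrderParameter U μ) :
    ∀ U₁ : ℝ, 0 < U₁ → ∃ U ∈ Set.Ioo (0:ℝ) U₁, ∃ δ ∈ Set.Ioo (0:ℝ) (1 / 2), ∃ μ : ℝ,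
      Tendsto (fun L : ℕ => ((hubbardTorusWith 2 (L + 1) 1 U μ).groundStateFunctional
        totalNumber).re / ((L + 1 : ℕ) : ℝ) ^ 2) atTop (𝓝 (1 - δ)) ∧ HasDWaveOrder U μ :=
  wcbcs_thinCrux_of_thinOrder
    (thinOrder_of_shiftedWindowFloor (μ₁ := -(2:ℝ) / 5) (μ₂ := -(7:ℝ) / 20) (by norm_num) (by norm_num) le_rfl
      (shiftedWindowFloor_of_controlCertWindow_of_klMechanismRel hctl hA hB hC hBr))

/-- **The rate-keeping crux (LINE-STATUS form (b)) from windowed control, the certificate and the relativised stub** — no (D_loc)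
(`rateKeepingCrux_of_shiftedWindowFloor`: density matching at every small `U` by the landed a.e.-matching chain).
[cite: KomaTasaki1994, §1] -/
theorem rateKeepingCrux_of_controlCertWindow_of_klMechanismRel
    (hctl : ∃ U₀ c : ℝ, 0 < U₀ ∧ 0 < c ∧ ∀ δ ∈ Set.Icc (0.10 : ℝ) 0.20, ∀ U β : ℝ, 0 < U → U ≤ U₀ → 0 < β →
      β ≤ Real.exp (c / U ^ 2) → ∀ (x y : Site 2) (σ σ' : Fin 2), ∃ S : ℂ,
        Tendsto (fun L : ℕ => hubbardThermalTwoPoint β U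
          (chemicalPotentialOfDensity (squareDispersion 1 0) (1 - δ)) L x y σ σ') atTop (𝓝 S))
    (hA : klCertB1gWinA.EnclosuresB1g) (hB : klCertB1gWinB.EnclosuresB1g) (hC : klCertB1gWinC.EnclosuresB1g)
    (hBr : ∀ μ₁ μ₂ γ U₁ U₀ c : ℝ, -2 ≤ μ₁ → μ₁ < μ₂ → μ₂ ≤ -(3:ℝ) / 10 → 0 < γ → 0 < U₁ → 0 < U₀ → 0 < c →
      (∀ μ ∈ Set.Icc μ₁ μ₂, ∀ U β : ℝ, 0 < U → U ≤ U₀ → 0 < β → β ≤ Real.exp (c / U ^ 2) →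
        ∀ (x y : Site 2) (σ σ' : Fin 2), ∃ S : ℂ,
          Tendsto (fun L : ℕ => hubbardThermalTwoPoint β U μ L x y σ σ') atTop (𝓝 S)) →
      (∀ U ∈ Set.Ioo (0:ℝ) U₁, ∀ μ ∈ Set.Icc μ₁ μ₂, ∀ χ : D4Irrep, χ ≠ D4Irrep.B1g →
        channelInf (squareDispersion 1 0) μ U D4Irrep.B1g + γ * U ^ 2 ≤ channelInf (squareDispersion 1 0) μ U χ) →
      ∃ U₀' C : ℝ, 0 < U₀' ∧ 0 < C ∧ ∀ U ∈ Set.Ioo (0:ℝ) U₀', ∀ μ ∈ Set.Icc (μ₁ + U / 2) μ₂,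
        Real.exp (-C / U ^ 2) ≤ dWaveOrderParameter U μ) :
    ∃ U₀ : ℝ, 0 < U₀ ∧ ∃ C : ℝ, 0 < C ∧ ∀ U ∈ Set.Ioo (0:ℝ) U₀, ∃ δ ∈ Set.Ioo (0:ℝ) (1 / 2), ∃ μ : ℝ,
      Tendsto (fun L : ℕ => ((hubbardTorusWith 2 (L + 1) 1 U μ).groundStateFunctional
        totalNumber).re / ((L + 1 : ℕ) : ℝ) ^ 2) atTop (𝓝 (1 - δ)) ∧
      Real.exp (-C / U ^ 2) ≤ dWaveOrderParameter U μ :=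
  rateKeepingCrux_of_shiftedWindowFloor (μ₁ := -(2:ℝ) / 5) (μ₂ := -(7:ℝ) / 20) (by norm_num) (by norm_num) le_rfl
    (shiftedWindowFloor_of_controlCertWindow_of_klMechanismRel hctl hA hB hC hBr)

/-- **The TYPED crux 4 `WcbcsBcsConstruction` BY NAME from windowed control, the certificate, the relativised stub and (D_loc)**
(`hD` = the registered no-density-jump stub of stmt-2010 VERBATIM; generic EOS composition
`wcbcsBcsConstruction_of_shiftedWindowFloor_of_noDensityJump` of `…TypedCrux` on the level window `[-2/5, -7/20]`,
`n(-2/5) ≥ 4/5 > 1/2`). [cite: KomaTasaki1994, §1] -/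
theorem wcbcsBcsConstruction_of_controlCertWindow_of_klMechanismRel_of_noDensityJump
    (hctl : ∃ U₀ c : ℝ, 0 < U₀ ∧ 0 < c ∧ ∀ δ ∈ Set.Icc (0.10 : ℝ) 0.20, ∀ U β : ℝ, 0 < U → U ≤ U₀ → 0 < β →
      β ≤ Real.exp (c / U ^ 2) → ∀ (x y : Site 2) (σ σ' : Fin 2), ∃ S : ℂ,
        Tendsto (fun L : ℕ => hubbardThermalTwoPoint β U
          (chemicalPotentialOfDensity (squareDispersion 1 0) (1 - δ)) L x y σ σ') atTop (𝓝 S))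
    (hA : klCertB1gWinA.EnclosuresB1g) (hB : klCertB1gWinB.EnclosuresB1g) (hC : klCertB1gWinC.EnclosuresB1g)
    (hBr : ∀ μ₁ μ₂ γ U₁ U₀ c : ℝ, -2 ≤ μ₁ → μ₁ < μ₂ → μ₂ ≤ -(3:ℝ) / 10 → 0 < γ → 0 < U₁ → 0 < U₀ → 0 < c →
      (∀ μ ∈ Set.Icc μ₁ μ₂, ∀ U β : ℝ, 0 < U → U ≤ U₀ → 0 < β → β ≤ Real.exp (c / U ^ 2) →
        ∀ (x y : Site 2) (σ σ' : Fin 2), ∃ S : ℂ,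
          Tendsto (fun L : ℕ => hubbardThermalTwoPoint β U μ L x y σ σ') atTop (𝓝 S)) →
      (∀ U ∈ Set.Ioo (0:ℝ) U₁, ∀ μ ∈ Set.Icc μ₁ μ₂, ∀ χ : D4Irrep, χ ≠ D4Irrep.B1g →
        channelInf (squareDispersion 1 0) μ U D4Irrep.B1g + γ * U ^ 2 ≤ channelInf (squareDispersion 1 0) μ U χ) →
      ∃ U₀' C : ℝ, 0 < U₀' ∧ 0 < C ∧ ∀ U ∈ Set.Ioo (0:ℝ) U₀', ∀ μ ∈ Set.Icc (μ₁ + U / 2) μ₂,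
        Real.exp (-C / U ^ 2) ≤ dWaveOrderParameter U μ)
    (hD : ∀ μ₁ μ₂ : ℝ, -2 ≤ μ₁ → μ₁ < μ₂ → μ₂ ≤ -(3:ℝ) / 10 → ∃ U_J : ℝ, 0 < U_J ∧ ∀ U ∈ Set.Ioo (0:ℝ) U_J,
      ∀ ν ∈ Set.Icc μ₁ μ₂, ∀ ε > 0, ∃ h > 0, ∃ᶠ L : ℕ in atTop,
        ((hubbardTorusWith 2 (L + 1) 1 U (ν + h)).groundStateFunctional totalNumber).re / ((L + 1 : ℕ) : ℝ) ^ 2 -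
          ((hubbardTorusWith 2 (L + 1) 1 U (ν - h)).groundStateFunctional totalNumber).re / ((L + 1 : ℕ) : ℝ) ^ 2 ≤ ε) :
    WcbcsBcsConstruction := by
  have hhalf : (1 : ℝ) / 2 < KohnLuttinger.filling (squareDispersion 1 0) (-(2:ℝ) / 5) :=
    lt_of_lt_of_le (by norm_num) klwM_filling_ge
  exact wcbcsBcsConstruction_of_shiftedWindowFloor_of_noDensityJump (μ₁ := -(2:ℝ) / 5) (μ₂ := -(7:ℝ) / 20)
    (by norm_num) (by norm_num) (by norm_num) hhalf
    (shiftedWindowFloor_of_controlCertWindow_of_klMechanismRel hctl hA hB hC hBr) hD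

/-! ### §3 Corollaries: the ONSET leaf `H1TwoPointLimitKLOnsetD` is a drop-in replacement for the leaf on H3 -/

/-- **THE ONSET DOOR: onset leaf + certificate + «(M_loc | normal-phase control)» + crux 2 ⇒ the summit.**  The onset leaf
`H1TwoPointLimitKLOnsetD` (stmt-HubbardSuperconductivity-19165; R2dH1′: control down to the fraction `1-η`, in log scale, of the
certified d-wave Kohn–Luttinger onset, on `δ ∈ [0.10, 0.20]`) BY NAME, the three window records, `hBr` VERBATIM and crux 2 BY NAME
imply `HubbardSuperconductivity` — through seat h1-p2's arrow `control_certWindow_of_onset` (the records give the sign of the `B1g`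
bottom, continuity bounds the onset rate) and the windowed door of §2. [cite: KomaTasaki1994, §1] -/
theorem hubbardSuperconductivity_of_onsetLeaf_of_klMechanismRel_of_ssbToTorusLRO (hon : H1TwoPointLimitKLOnsetD)
    (hA : klCertB1gWinA.EnclosuresB1g) (hB : klCertB1gWinB.EnclosuresB1g) (hC : klCertB1gWinC.EnclosuresB1g)
    (hBr : ∀ μ₁ μ₂ γ U₁ U₀ c : ℝ, -2 ≤ μ₁ → μ₁ < μ₂ → μ₂ ≤ -(3:ℝ) / 10 → 0 < γ → 0 < U₁ → 0 < U₀ → 0 < c →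
      (∀ μ ∈ Set.Icc μ₁ μ₂, ∀ U β : ℝ, 0 < U → U ≤ U₀ → 0 < β → β ≤ Real.exp (c / U ^ 2) →
        ∀ (x y : Site 2) (σ σ' : Fin 2), ∃ S : ℂ,
          Tendsto (fun L : ℕ => hubbardThermalTwoPoint β U μ L x y σ σ') atTop (𝓝 S)) →
      (∀ U ∈ Set.Ioo (0:ℝ) U₁, ∀ μ ∈ Set.Icc μ₁ μ₂, ∀ χ : D4Irrep, χ ≠ D4Irrep.B1g →
        channelInf (squareDispersion 1 0) μ U D4Irrep.B1g + γ * U ^ 2 ≤ channelInf (squareDispersion 1 0) μ U χ) →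
      ∃ U₀' C : ℝ, 0 < U₀' ∧ 0 < C ∧ ∀ U ∈ Set.Ioo (0:ℝ) U₀', ∀ μ ∈ Set.Icc (μ₁ + U / 2) μ₂,
        Real.exp (-C / U ^ 2) ≤ dWaveOrderParameter U μ)
    (h2 : WcbcsSsbToTorusLRO) : _root_.HubbardSuperconductivity :=
  hubbardSuperconductivity_of_controlCertWindow_of_klMechanismRel_of_ssbToTorusLRO
    (control_certWindow_of_onset hA hB hC hon) hA hB hC hBr h2

/-- **The thin crux from the onset leaf, the certificate and the relativised stub.** [cite: KomaTasaki1994, §1] -/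
theorem thinCrux_of_onsetLeaf_of_klMechanismRel (hon : H1TwoPointLimitKLOnsetD)
    (hA : klCertB1gWinA.EnclosuresB1g) (hB : klCertB1gWinB.EnclosuresB1g) (hC : klCertB1gWinC.EnclosuresB1g)
    (hBr : ∀ μ₁ μ₂ γ U₁ U₀ c : ℝ, -2 ≤ μ₁ → μ₁ < μ₂ → μ₂ ≤ -(3:ℝ) / 10 → 0 < γ → 0 < U₁ → 0 < U₀ → 0 < c →
      (∀ μ ∈ Set.Icc μ₁ μ₂, ∀ U β : ℝ, 0 < U → U ≤ U₀ → 0 < β → β ≤ Real.exp (c / U ^ 2) →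
        ∀ (x y : Site 2) (σ σ' : Fin 2), ∃ S : ℂ,
          Tendsto (fun L : ℕ => hubbardThermalTwoPoint β U μ L x y σ σ') atTop (𝓝 S)) →
      (∀ U ∈ Set.Ioo (0:ℝ) U₁, ∀ μ ∈ Set.Icc μ₁ μ₂, ∀ χ : D4Irrep, χ ≠ D4Irrep.B1g →
        channelInf (squareDispersion 1 0) μ U D4Irrep.B1g + γ * U ^ 2 ≤ channelInf (squareDispersion 1 0) μ U χ) →
      ∃ U₀' C : ℝ, 0 < U₀' ∧ 0 < C ∧ ∀ U ∈ Set.Ioo (0:ℝ) U₀', ∀ μ ∈ Set.Icc (μ₁ + U / 2) μ₂,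
        Real.exp (-C / U ^ 2) ≤ dWaveOrderParameter U μ) :
    ∀ U₁ : ℝ, 0 < U₁ → ∃ U ∈ Set.Ioo (0:ℝ) U₁, ∃ δ ∈ Set.Ioo (0:ℝ) (1 / 2), ∃ μ : ℝ,
      Tendsto (fun L : ℕ => ((hubbardTorusWith 2 (L + 1) 1 U μ).groundStateFunctional
        totalNumber).re / ((L + 1 : ℕ) : ℝ) ^ 2) atTop (𝓝 (1 - δ)) ∧ HasDWaveOrder U μ :=
  thinCrux_of_controlCertWindow_of_klMechanismRel (control_certWindow_of_onset hA hB hC hon) hA hB hC hBr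

/-- **The rate-keeping crux from the onset leaf, the certificate and the relativised stub** — no (D_loc). [cite: KomaTasaki1994, §1] -/
theorem rateKeepingCrux_of_onsetLeaf_of_klMechanismRel (hon : H1TwoPointLimitKLOnsetD)
    (hA : klCertB1gWinA.EnclosuresB1g) (hB : klCertB1gWinB.EnclosuresB1g) (hC : klCertB1gWinC.EnclosuresB1g)
    (hBr : ∀ μ₁ μ₂ γ U₁ U₀ c : ℝ, -2 ≤ μ₁ → μ₁ < μ₂ → μ₂ ≤ -(3:ℝ) / 10 → 0 < γ → 0 < U₁ → 0 < U₀ → 0 < c →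
      (∀ μ ∈ Set.Icc μ₁ μ₂, ∀ U β : ℝ, 0 < U → U ≤ U₀ → 0 < β → β ≤ Real.exp (c / U ^ 2) →
        ∀ (x y : Site 2) (σ σ' : Fin 2), ∃ S : ℂ,
          Tendsto (fun L : ℕ => hubbardThermalTwoPoint β U μ L x y σ σ') atTop (𝓝 S)) →
      (∀ U ∈ Set.Ioo (0:ℝ) U₁, ∀ μ ∈ Set.Icc μ₁ μ₂, ∀ χ : D4Irrep, χ ≠ D4Irrep.B1g →
        channelInf (squareDispersion 1 0) μ U D4Irrep.B1g + γ * U ^ 2 ≤ channelInf (squareDispersion 1 0) μ U χ) →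
      ∃ U₀' C : ℝ, 0 < U₀' ∧ 0 < C ∧ ∀ U ∈ Set.Ioo (0:ℝ) U₀', ∀ μ ∈ Set.Icc (μ₁ + U / 2) μ₂,
        Real.exp (-C / U ^ 2) ≤ dWaveOrderParameter U μ) :
    ∃ U₀ : ℝ, 0 < U₀ ∧ ∃ C : ℝ, 0 < C ∧ ∀ U ∈ Set.Ioo (0:ℝ) U₀, ∃ δ ∈ Set.Ioo (0:ℝ) (1 / 2), ∃ μ : ℝ,
      Tendsto (fun L : ℕ => ((hubbardTorusWith 2 (L + 1) 1 U μ).groundStateFunctional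
        totalNumber).re / ((L + 1 : ℕ) : ℝ) ^ 2) atTop (𝓝 (1 - δ)) ∧
      Real.exp (-C / U ^ 2) ≤ dWaveOrderParameter U μ :=
  rateKeepingCrux_of_controlCertWindow_of_klMechanismRel (control_certWindow_of_onset hA hB hC hon) hA hB hC hBr

/-- **The TYPED crux 4 `WcbcsBcsConstruction` BY NAME from the onset leaf, the certificate, the relativised stub and (D_loc).**
[cite: KomaTasaki1994, §1] -/
theorem wcbcsBcsConstruction_of_onsetLeaf_of_klMechanismRel_of_noDensityJump (hon : H1TwoPointLimitKLOnsetD)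
    (hA : klCertB1gWinA.EnclosuresB1g) (hB : klCertB1gWinB.EnclosuresB1g) (hC : klCertB1gWinC.EnclosuresB1g)
    (hBr : ∀ μ₁ μ₂ γ U₁ U₀ c : ℝ, -2 ≤ μ₁ → μ₁ < μ₂ → μ₂ ≤ -(3:ℝ) / 10 → 0 < γ → 0 < U₁ → 0 < U₀ → 0 < c →
      (∀ μ ∈ Set.Icc μ₁ μ₂, ∀ U β : ℝ, 0 < U → U ≤ U₀ → 0 < β → β ≤ Real.exp (c / U ^ 2) →
        ∀ (x y : Site 2) (σ σ' : Fin 2), ∃ S : ℂ,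
          Tendsto (fun L : ℕ => hubbardThermalTwoPoint β U μ L x y σ σ') atTop (𝓝 S)) →
      (∀ U ∈ Set.Ioo (0:ℝ) U₁, ∀ μ ∈ Set.Icc μ₁ μ₂, ∀ χ : D4Irrep, χ ≠ D4Irrep.B1g →
        channelInf (squareDispersion 1 0) μ U D4Irrep.B1g + γ * U ^ 2 ≤ channelInf (squareDispersion 1 0) μ U χ) →
      ∃ U₀' C : ℝ, 0 < U₀' ∧ 0 < C ∧ ∀ U ∈ Set.Ioo (0:ℝ) U₀', ∀ μ ∈ Set.Icc (μ₁ + U / 2) μ₂,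
        Real.exp (-C / U ^ 2) ≤ dWaveOrderParameter U μ)
    (hD : ∀ μ₁ μ₂ : ℝ, -2 ≤ μ₁ → μ₁ < μ₂ → μ₂ ≤ -(3:ℝ) / 10 → ∃ U_J : ℝ, 0 < U_J ∧ ∀ U ∈ Set.Ioo (0:ℝ) U_J,
      ∀ ν ∈ Set.Icc μ₁ μ₂, ∀ ε > 0, ∃ h > 0, ∃ᶠ L : ℕ in atTop,
        ((hubbardTorusWith 2 (L + 1) 1 U (ν + h)).groundStateFunctional totalNumber).re / ((L + 1 : ℕ) : ℝ) ^ 2 -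
          ((hubbardTorusWith 2 (L + 1) 1 U (ν - h)).groundStateFunctional totalNumber).re / ((L + 1 : ℕ) : ℝ) ^ 2 ≤ ε) :
    WcbcsBcsConstruction :=
  wcbcsBcsConstruction_of_controlCertWindow_of_klMechanismRel_of_noDensityJump (control_certWindow_of_onset hA hB hC hon)
    hA hB hC hBr hD

end Summit.HubbardSuperconductivity.HubbardSuperconductivity.Theorems.R2dH1

end
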